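import Literature.NumberTheory.EllipticCurves.PAdicTwoVariableColemanImageCocycleOfUnitsGalois
import Literature.NumberTheory.GaloisRepresentations.LubinTateColemanUnitsImageTraceTwo
import HarnessLib

/-!
# The Galois cocycle of the two-variable Coleman image ON THE `ℤ/d`-TRACE, and de Shalit II §4.12 for an unramified tower of ARBITRARY
# degree `d·p^m`: **∃! `L_ε ∈ 𝒪_F⟦X⟧⟦T⟧` with `φ_ε(Σ_j Col(β_c)(j)) = (t_{χ(σ̃_c)}·g_{σ̃_c} − N_c)·L_ε`**

De Shalit, *Iwasawa theory of elliptic curves with complex multiplication* (1987), I §3.1/§3.4/§3.8 (17), II §2.4 (ii), §4.12 (29)–(33), §4.14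
Step 1.  The sibling `PAdicTwoVariableColemanImageCocycleOfUnitsGalois` (g14 S23) proved, from the LEVELWISE unit relation
`(σ̃_c·β_{a,m})·β_{c,m}^{n_a} = (σ̃_a·β_{c,m})·β_{a,m}^{n_c}` for ARBITRARY `σ̃_i ∈ Γ_F` with Amice pairs `(g_i, s_i)`, the module cocycle
`𝒯_c(Col β_a) + n_a Col β_c = 𝒯_a(Col β_c) + n_c Col β_a` in `M = (ZMod d → M₁)` and — for `d = 1` ONLY (`[Unique (ZMod d)]`, where the
`ℤ/d`-shifts `s_i` of the operators `𝒯_i = σ_{χ(σ̃_i)} ∘ (C g_i •) ∘ shift_{s_i}` are invisible) — the divided element `L_ε`.  For `d > 1` the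
shifts do not cancel componentwise; but they DO cancel on the `ℤ/d`-trace `Σ : M → M₁` (`indexTraceₗ_galOpₗ`:
`Σ ∘ 𝒯_{v,g,s} = σ_v ∘ (C g •) ∘ Σ`, `LubinTateColemanUnitsImageTraceTwo`).  THIS file proves, for EVERY `d` (0 sorry, no definitions):

* ★★ `colemanImageCoh_twistCocycle_trace` — with `y_i := Σ_j Col(β_i)(j) ∈ M₁`:
  `σ_{χ(σ̃_c)}(C g_c • y_a) + C n_a • y_c = σ_{χ(σ̃_a)}(C g_a • y_c) + C n_c • y_a`;
* ★★★ **`existsUnique_colemanDeltaCoinvFun_colemanImageCoh_trace_eq_twistMul`** — with `χ_π(σ̃_{a₁}) = γ`, `π ∣ n_{a₁} − 1` and ONE auxiliary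
  `a₂` (non-zero Weierstrass value at `b = n_{a₁} g_{a₁}⁻¹ − 1`): **∃! `L ∈ Λ`, `φ_ε(Σ_j Col(β_c)(j)) = (t_{χ(σ̃_c)}·C g_c − C n_c)·L` ∀ `c`**;
* `map_span_colemanImageCoh_trace_eq_span_twistMul` (`φ_ε(Λ·span{Σ Col β_c}) = span{(t_{χ(σ̃_c)} C g_c − C n_c)·L}` — III §1.4 (5) on the trace).

The trace is the projection onto the part of `Λ(𝒢)` on which the prime-to-`p` torsion `ℤ/d ≤ Gal(E_∞/F)` acts trivially — the only part
seen by a character of `p`-power order (the quadratic branches of the brick-(c) chain); for `d = 1` it is evaluation at the unique index and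
these are the statements of §3 of the sibling.  Cell `bsd-print-cf2`, width seat `bsd-line-cf2c-w7` g17.

## References
* E. de Shalit, *Iwasawa theory of elliptic curves with complex multiplication* (1987), Ch. I §3.1, §3.4 Lemma (ii), §3.8 (17); Ch. II §2.4 (ii),
  §4.12 (29)–(33), §4.14; Ch. III §1.1 (Exercise (i)), §1.3, §1.4 (5). [deShalit1987]
* L. C. Washington, *Introduction to Cyclotomic Fields*, 2nd ed. (1997), §7.1 Prop. 7.2. [Washington1997]
-/

noncomputable section

namespace Literature.NumberTheory.EllipticCurves

open ValuativeRel IsLocalRing Field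
open Literature.NumberTheory.GaloisRepresentations Literature.NumberTheory.GaloisRepresentations.IsNonarchimedeanLocalField
  Literature.NumberTheory.GaloisRepresentations.LubinTate
open Literature.RingTheory.PowerSeries (maxEval)

variable {F : Type} [Field F] [ValuativeRel F] [TopologicalSpace F] [IsNonarchimedeanLocalField F]

attribute [local instance] ltNormUniformSpace ltNormIsUniformAddGroup rk1 nF nE fintypeResidueField
attribute [local instance] RelNormCoherentUnits.instCommMonoid
attribute [local instance] isAdicComplete_maximalIdeal_powerSeries_integer

variable {p : ℕ} [hp : Fact p.Prime] {d : ℕ} (hd : d.Coprime p)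
variable {π : 𝒪[F]} (hπ : (valuation F).IsUniformizer (π : F))
variable (E : ℕ → IntermediateField F (AlgebraicClosure F)) [∀ m, FiniteDimensional F (E m)] [∀ m, Normal F (E m)]
  [∀ m, IsGalois F (E m)] (hmono : Monotone E) (hE : ∀ m, E m ≤ maxUnramified F) (hdeg : ∀ m, Module.finrank F (E m) = d * p ^ m)
  {σ₀ : absoluteGaloisGroup F} (hσ₀ : IsAbsArithFrob σ₀) (hq : residueFieldCard F = 2)
variable (u : (LTCoeff F)ˣ) (hu : LTCoeff.of F π = residueFieldCard F * u) (γ : 𝒪[F]ˣ)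
variable [IsAdicComplete (Ideal.span {intBase F (LTCoeff.of F π)}) (PowerSeries 𝒪[F])]
variable (w : 𝒪[F]ˣ) (hγ : (γ : 𝒪[F]) = 1 + π ^ 2 * w) (ε : PowerSeries (PowerSeries 𝒪[F])) (hε : ε * ε = 1)
variable [NeZero d] [IsAdicComplete (Ideal.span {(p : 𝒪[F])}) 𝒪[F]]
variable {θ : ∀ m, unitBall (E m)} (hθ : ∀ m, IsIntegralNormalGen (E m) (θ m))
  (hcoh : ∀ m, unitBallTrace (hmono (Nat.le_succ m)) (θ (m + 1)) = θ m)

/-! ### The cocycle and the divided element on the `ℤ/d`-trace (every `d`) -/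

include hdeg in
/-- ★★ **The LEVELWISE unit relation for ARBITRARY Galois indices gives the `g`-twisted cocycle ON THE TRACE, for every `d`**: if at every
level `m` `(σ̃_c·β_{a,m})·β_{c,m}^{n_a} = (σ̃_a·β_{c,m})·β_{a,m}^{n_c}` (`σ̃_i ∈ Γ_F` with Amice pairs `(g_i, s_i)`; NO condition on `σ̃_i|_{E_∞}`,
no condition on `d`), then `y i := Σ_j Col(β i)(j)` satisfies `σ_{χ(σ̃_c)}(C g_c • y a) + C n_a • y c = σ_{χ(σ̃_a)}(C g_a • y c) + C n_c • y a` —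
the `ℤ/d`-shifts `s_i` cancel under `Σ`. [cite: deShalit1987, Ch. II §2.4 (ii), §4.12 (29), §4.14; Ch. I §3.8 (17)] -/
theorem colemanImageCoh_twistCocycle_trace {I : Type*} (β : I → coherentFamilies hπ E hmono) (σ : I → absoluteGaloisGroup F)
    (g : I → (PowerSeries 𝒪[F])ˣ) (s : I → ZMod d)
    (hg : ∀ i m, ∃ a : ℕ, (∀ x : E m, σ i • (x : AlgebraicClosure F) = (σ₀ ^ a) • (x : AlgebraicClosure F)) ∧
      ((1 + PowerSeries.X : PowerSeries 𝒪[F]) ^ p ^ m - 1) ∣ (g i : PowerSeries 𝒪[F]) - (1 + PowerSeries.X) ^ a ∧ (a : ZMod d) = s i)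
    (n : I → ℕ)
    (hrel : ∀ (a c : I) (m : ℕ), ((β a).1 m).galAct (σ c) * (β c).1 m ^ n a = ((β c).1 m).galAct (σ a) * (β a).1 m ^ n c)
    (a c : I) :
    unitTwistₗ hπ hq (intBase F) u hu γ (lubinTateChar hπ (σ c))
        ((PowerSeries.C (g c : PowerSeries 𝒪[F]) : PowerSeries (PowerSeries 𝒪[F])) •
          indexTraceₗ hπ hq u hu γ (colemanImageCoh hd hπ E hmono hE hdeg hσ₀ hq u hu γ hθ hcoh (β a))) +
        (PowerSeries.C ((n a : ℕ) : PowerSeries 𝒪[F]) : PowerSeries (PowerSeries 𝒪[F])) •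
          indexTraceₗ hπ hq u hu γ (colemanImageCoh hd hπ E hmono hE hdeg hσ₀ hq u hu γ hθ hcoh (β c)) =
      unitTwistₗ hπ hq (intBase F) u hu γ (lubinTateChar hπ (σ a))
        ((PowerSeries.C (g a : PowerSeries 𝒪[F]) : PowerSeries (PowerSeries 𝒪[F])) •
          indexTraceₗ hπ hq u hu γ (colemanImageCoh hd hπ E hmono hE hdeg hσ₀ hq u hu γ hθ hcoh (β c))) +
        (PowerSeries.C ((n c : ℕ) : PowerSeries 𝒪[F]) : PowerSeries (PowerSeries 𝒪[F])) •
          indexTraceₗ hπ hq u hu γ (colemanImageCoh hd hπ E hmono hE hdeg hσ₀ hq u hu γ hθ hcoh (β a)) := by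
  have hrel' : ∀ a c : I, galActCoherent hπ E hmono (σ c) (β a) * β c ^ n a = galActCoherent hπ E hmono (σ a) (β c) * β a ^ n c :=
    fun a c => Subtype.ext (funext fun m => by
      simp only [Submonoid.coe_mul, SubmonoidClass.coe_pow, Pi.mul_apply, Pi.pow_apply, coe_galActCoherent]
      exact hrel a c m)
  have h := twist_cocycle_of_map_mul_of_rel (R := PowerSeries (PowerSeries 𝒪[F]))
    (colemanImageCoh hd hπ E hmono hE hdeg hσ₀ hq u hu γ hθ hcoh) (colemanImageCoh_mul hd hπ E hmono hE hdeg hσ₀ hq u hu γ hθ hcoh)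
    (colemanImageCoh_one hd hπ E hmono hE hdeg hσ₀ hq u hu γ hθ hcoh) (fun i => galActCoherent hπ E hmono (σ i))
    (fun i G => galOpₗ hπ hq u hu γ (lubinTateChar hπ (σ i)) (g i : PowerSeries 𝒪[F]) (s i) G)
    (fun i b => colemanImageCoh_galAct_amice hd hπ E hmono hE hdeg hσ₀ hq u hu γ hθ hcoh b (σ i) (hg i)) β n hrel' a c
  have hT := congrArg (indexTraceₗ hπ hq u hu γ) h
  rw [map_add, map_add, map_smul, map_smul, indexTraceₗ_galOpₗ, indexTraceₗ_galOpₗ] at hT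
  rwa [map_natCast, map_natCast]

include hdeg hε in
/-- ★★★ **DE SHALIT II §4.12 IN THE TWO-VARIABLE FRAME FOR GALOIS-INDEXED FAMILIES, ON THE `ℤ/d`-TRACE, FOR EVERY `d`** (`ε`-part, one prime,
`q = 2`): let the coherent tower families `β_c` satisfy the levelwise relation of `colemanImageCoh_twistCocycle_trace` for indices `σ̃_c ∈ Γ_F` with
Amice pairs `(g_c, s_c)` (arbitrary action on `E_∞`), let `a₁` have `χ_π(σ̃_{a₁}) = γ` and `π ∣ n_{a₁} − 1`, and let ONE index `a₂` have
non-zero Weierstrass value `(t_{χ(σ̃_{a₂})} − C(n_{a₂} g_{a₂}⁻¹))(n_{a₁} g_{a₁}⁻¹ − 1) ≠ 0` in `𝒪_F⟦X⟧`.  Then **there is a UNIQUE `L ∈ Λ = 𝒪_F⟦X⟧⟦T⟧`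
with `φ_ε(Σ_j Col(β c)(j)) = (t_{χ(σ̃_c)}·C g_c − C n_c)·L` for every `c`** — de Shalit's two-variable `μ` (`ε`-part, trivial on `ℤ/d`) from
`μ_𝔞 = (σ_𝔞 − N𝔞)μ` with the TRUE Artin symbols. [cite: deShalit1987, Ch. II §4.12 (29)–(33), §4.14 Step 1; Ch. III §1.4 (5)]
[cite: Washington1997, §7.1 Prop. 7.2] -/
theorem existsUnique_colemanDeltaCoinvFun_colemanImageCoh_trace_eq_twistMul {I : Type*} (β : I → coherentFamilies hπ E hmono)
    (σ : I → absoluteGaloisGroup F) (g : I → (PowerSeries 𝒪[F])ˣ) (s : I → ZMod d)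
    (hg : ∀ i m, ∃ a : ℕ, (∀ x : E m, σ i • (x : AlgebraicClosure F) = (σ₀ ^ a) • (x : AlgebraicClosure F)) ∧
      ((1 + PowerSeries.X : PowerSeries 𝒪[F]) ^ p ^ m - 1) ∣ (g i : PowerSeries 𝒪[F]) - (1 + PowerSeries.X) ^ a ∧ (a : ZMod d) = s i)
    (n : I → ℕ)
    (hrel : ∀ (a c : I) (m : ℕ), ((β a).1 m).galAct (σ c) * (β c).1 m ^ n a = ((β c).1 m).galAct (σ a) * (β a).1 m ^ n c)
    (a₁ a₂ : I) (hv₁ : lubinTateChar hπ (σ a₁) = γ) (hn₁ : (π : 𝒪[F]) ∣ (n a₁ : 𝒪[F]) - 1)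
    (ha₂ : maxEval (natCast_mul_inv_sub_one_mem_maximalIdeal hπ hn₁ (g a₁) (constantCoeff_eq_one_of_amice E (p := p) (hg a₁)))
      (colemanDeltaCoinvFun hπ hq (intBase F) u hu γ (eq_zero_of_C_pi_mul_eq_zero_integer hπ) w hγ ε
          (unitTwistₗ hπ hq (intBase F) u hu γ (lubinTateChar hπ (σ a₂)) (TActModule.ofPS _ _ 1)) -
        PowerSeries.C (((n a₂ : ℕ) : PowerSeries 𝒪[F]) * ((g a₂)⁻¹ : (PowerSeries 𝒪[F])ˣ))) ≠ 0) :
    ∃! L : PowerSeries (PowerSeries 𝒪[F]), ∀ c : I,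
      colemanDeltaCoinvFun hπ hq (intBase F) u hu γ (eq_zero_of_C_pi_mul_eq_zero_integer hπ) w hγ ε
          (indexTraceₗ hπ hq u hu γ (colemanImageCoh hd hπ E hmono hE hdeg hσ₀ hq u hu γ hθ hcoh (β c))) =
        (colemanDeltaCoinvFun hπ hq (intBase F) u hu γ (eq_zero_of_C_pi_mul_eq_zero_integer hπ) w hγ ε
            (unitTwistₗ hπ hq (intBase F) u hu γ (lubinTateChar hπ (σ c)) (TActModule.ofPS _ _ 1)) *
            PowerSeries.C (g c : PowerSeries 𝒪[F]) - PowerSeries.C ((n c : ℕ) : PowerSeries 𝒪[F])) * L :=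
  existsUnique_colemanDeltaCoinvFun_eq_twistMul_of_rel hπ hq (intBase F) u hu γ (eq_zero_of_C_pi_mul_eq_zero_integer hπ) w hγ ε hε
    (fun c => indexTraceₗ hπ hq u hu γ (colemanImageCoh hd hπ E hmono hE hdeg hσ₀ hq u hu γ hθ hcoh (β c))) (fun c => lubinTateChar hπ (σ c)) g
    (fun c => ((n c : ℕ) : PowerSeries 𝒪[F]))
    (fun a c => colemanImageCoh_twistCocycle_trace hd hπ E hmono hE hdeg hσ₀ hq u hu γ hθ hcoh β σ g s hg n hrel a c) a₁ a₂ hv₁ _ ha₂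

include hdeg in
/-- ★ **`φ_ε(Λ·span{Σ Col β_c}) = span{(t_{χ(σ̃_c)}·C g_c − C n_c)·L}`** — de Shalit III §1.4 (5) `i(𝒞_𝔣) = μ(𝔣)·Λ₀` on the `ε`-part of the
`ℤ/d`-trace, with the TRUE `Λ₀ = (σ_𝔞 − N𝔞 : 𝔞)` (III §1.1 Exercise (i)), for any `L` with the property of
`existsUnique_colemanDeltaCoinvFun_colemanImageCoh_trace_eq_twistMul`. [cite: deShalit1987, Ch. III §1.1, §1.4 (5); Ch. II §4.12 (33)] -/
theorem map_span_colemanImageCoh_trace_eq_span_twistMul {I : Type*} (β : I → coherentFamilies hπ E hmono) (σ : I → absoluteGaloisGroup F)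
    (g : I → (PowerSeries 𝒪[F])ˣ) (n : I → ℕ) (L : PowerSeries (PowerSeries 𝒪[F]))
    (hL : ∀ c : I, colemanDeltaCoinvFun hπ hq (intBase F) u hu γ (eq_zero_of_C_pi_mul_eq_zero_integer hπ) w hγ ε
          (indexTraceₗ hπ hq u hu γ (colemanImageCoh hd hπ E hmono hE hdeg hσ₀ hq u hu γ hθ hcoh (β c))) =
        (colemanDeltaCoinvFun hπ hq (intBase F) u hu γ (eq_zero_of_C_pi_mul_eq_zero_integer hπ) w hγ ε
            (unitTwistₗ hπ hq (intBase F) u hu γ (lubinTateChar hπ (σ c)) (TActModule.ofPS _ _ 1)) *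
            PowerSeries.C (g c : PowerSeries 𝒪[F]) - PowerSeries.C ((n c : ℕ) : PowerSeries 𝒪[F])) * L) :
    (Submodule.span (PowerSeries (PowerSeries 𝒪[F]))
        (Set.range fun c => indexTraceₗ hπ hq u hu γ (colemanImageCoh hd hπ E hmono hE hdeg hσ₀ hq u hu γ hθ hcoh (β c)))).map
        (colemanDeltaCoinvFun hπ hq (intBase F) u hu γ (eq_zero_of_C_pi_mul_eq_zero_integer hπ) w hγ ε) =
      Ideal.span (Set.range fun c =>
        (colemanDeltaCoinvFun hπ hq (intBase F) u hu γ (eq_zero_of_C_pi_mul_eq_zero_integer hπ) w hγ ε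
            (unitTwistₗ hπ hq (intBase F) u hu γ (lubinTateChar hπ (σ c)) (TActModule.ofPS _ _ 1)) *
            PowerSeries.C (g c : PowerSeries 𝒪[F]) - PowerSeries.C ((n c : ℕ) : PowerSeries 𝒪[F])) * L) :=
  colemanDeltaCoinvFun_map_span_range_eq_span_twistMul hπ hq (intBase F) u hu γ (eq_zero_of_C_pi_mul_eq_zero_integer hπ) w hγ ε
    (fun c => indexTraceₗ hπ hq u hu γ (colemanImageCoh hd hπ E hmono hE hdeg hσ₀ hq u hu γ hθ hcoh (β c))) (fun c => lubinTateChar hπ (σ c)) g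
    (fun c => ((n c : ℕ) : PowerSeries 𝒪[F])) L hL

end Literature.NumberTheory.EllipticCurves
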